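import Summits.BirchSwinnertonDyer.BirchSwinnertonDyer.Theorems.AlignedTransportAtTwoMainConjectureOfRankZeroBSDAtTwoSelmerLayerMuDoorComplete
import Summits.BirchSwinnertonDyer.Rank1Residual.X5.KatoOrdTwoTowerGapIff
import HarnessLib

/-!
# Route `AlignedTransportAtTwo`, crux C2 `MainConjectureOfRankZeroBSDAtTwo` (stmt-BirchSwinnertonDyer-22298):
# BRIDGE — cell `bsd-2adic`'s tower-gap certificate `X5.O1.TowerGapAtTwo W` (X-level, K10/T10) IS the Selmer rank-jump
# Σ₁ statement «∃ j < k, #Sel_k[2]·#ker g_k·2^{2^j} < #Sel_j[2]·2^{2^k}» (Selmer level), for good-ordinary-`2` curves without rational `2`-torsion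

HONEST FRAMING (cell `bsd-f1-sign2`, WIDTH-5 attached prover seat `bsd-line-att-p5` gen 43 on line `birth` of the lead
`bsd-line-att-p2`; `--supports` stmt-BirchSwinnertonDyer-22298, closes nothing; BSD is NOT proved by any of this; the crux
C2, its verdict «blocked-on `Rank1Residual.GreenbergMuConjectureIrreducible`» and every registered stub are untouched).
THEOREMS ONLY — no `def`, no instance, no named fact, no `sorry`.

DISCLOSURE / PLACEMENT. This seat's rank-jump files (`Literature/…/IwasawaModuleMuZeroOfRankJump`, `…/IwasawaModuleLambdaLayersOfRankJump`,
`Theorems/…SelmerLayerMuDoor{Count,,Crux,Complete}`) re-derive IN SUBSTANCE cell `bsd-2adic`'s TOWER-GAP certificate of 2026-08-28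
(seat `bsd-2adic-tower-1` / `bsd-2adic-ord`: `X5.TowerGap.isTorsion_and_mu_eq_zero_of_card_quotient_lt`,
`X5.TowerGap.exists_card_quotient_lt_iff_isTorsion_and_mu_eq_zero`, `X5.O1.towerGapAtTwo_iff_isTorsion_and_mu_eq_zero`,
`KatoHalfPinch.towerGapAtTwo_of_layerSelmer_{nat,cert,sharp}` with EXPLICIT local constants, and this cell's own
`AlignedTransportAtTwoSeedKernelEC.mazurMainConjecture_two_of_bsdp_of_towerGap`). What the rank-jump files ADD: the number-field /
arbitrary-`ℤ_p`-extension / abstract-`ker g` formulation with the lineage's UNCONDITIONAL control inputs over `ℚ` at every good ordinary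
`p`, the `λ`-bound `p^{λ(X)} ≤ #Sel_k[p]·#ker g_k`, `#(Hom(B,ℚ/ℤ)/p) = #B[p]` / `#X/(ω_n,p)X = #Sel_∞^{Γ_n}[p]` for any `K`, and the
SELMER-LEVEL completeness (`…SelmerLayerMuDoorComplete`, Lemma 3.5 over `ℚ`). This file records the identification of the two currencies:

* ★★★ `towerGapAtTwo_iff_forall_exists_selmer_rankJump` — for `W/ℚ` globally minimal, good ordinary at `2`, without rational `2`-torsion:
  **`X5.O1.TowerGapAtTwo W` ⟺ for every cyclotomic `κ` with a topological generator `γ` that is a cyclotomic variable,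
  ∃ `j < k`, `#Sel_k[2]·#ker g_k·2^{2^j} < #Sel_j[2]·2^{2^k}`** (`Sel_n = W.selmerLayer κ n`, `ker g_n = W.KerG κ n`). So every consumer of
  K10 (`SeedKernelEC.mazurMainConjecture_two_of_bsdp_of_towerGap`, `X5.O1.bsdp_two_of_towerGap_of_lowerBound`,
  `charIdeal_dvd_of_towerGap`, …) is fed by ONE two-layer `2`-descent inequality with the abstract local defect `#ker g_k`, and conversely.
* `towerGapAtTwo_of_selmer_rankJump` — the practical direction alone (no cyclotomic-variable binder needed).

References: R. Greenberg, LNM 1716 (1999), §1 Conj. 1.11, §3 Lemmas 3.1–3.5 [GreenbergLNM1716]; L. Washington, GTM 83, §13.2–13.3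
[Washington1997]; T. Fukuda, Proc. Japan Acad. 70 (1994) [Fukuda1994].
-/

set_option linter.dupNamespace false
set_option autoImplicit false

noncomputable section

open scoped Classical AddSubgroup

namespace Summit.BirchSwinnertonDyer.BirchSwinnertonDyer.Theorems.AlignedTransportAtTwoSelmerLayerMuDoorTowerGap

open WeierstrassCurve Literature.NumberTheory.EllipticCurves Literature.NumberTheory.EllipticCurves.Greenberg1999
  Summit.BirchSwinnertonDyer.Rank1Residual.X5.O1
  Summit.BirchSwinnertonDyer.BirchSwinnertonDyer.Theorems.AlignedTransportAtTwoSelmerLayerMuDoor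
  Summit.BirchSwinnertonDyer.BirchSwinnertonDyer.Theorems.AlignedTransportAtTwoSelmerLayerMuDoorComplete

variable (W : WeierstrassCurve ℚ) [W.IsElliptic] [W.IsGloballyMinimal]

/-- **The practical direction: ONE two-layer `2`-descent inequality per cyclotomic `κ` gives cell `bsd-2adic`'s certificate
`X5.O1.TowerGapAtTwo W`** (`W` good ordinary at `2`, no rational `2`-torsion): the door gives `X` torsion with `μ₂ = 0` for every
cyclotomic datum, and `towerGapAtTwo_iff_isTorsion_and_mu_eq_zero` converts. [cite: GreenbergLNM1716, §1 Conj. 1.11] [cite: Washington1997, §13.2] -/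
theorem towerGapAtTwo_of_selmer_rankJump (hord : IsOrdinaryAt W 2) (ht : ∀ x : ℚ, ¬ HasRationalTwoTorsionX W x)
    (hjump : ∀ κ : ZpExtension ℚ 2, κ.IsCyclotomic →
      ∃ j k : ℕ, j < k ∧
        Nat.card ((↥(W.selmerLayer κ k))[(2 : ℤ)]) * Nat.card (W.KerG κ k) * 2 ^ (2 ^ j) <
          Nat.card ((↥(W.selmerLayer κ j))[(2 : ℤ)]) * 2 ^ (2 ^ k)) :
    TowerGapAtTwo W := by
  refine (towerGapAtTwo_iff_isTorsion_and_mu_eq_zero W).mpr fun κ γ hκ hγ _ D ↦ ?_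
  obtain ⟨j, k, hjk, hlt⟩ := hjump κ hκ
  have h := seedMuZero_of_selmer_rankJump_two W hord ht κ hκ hγ D hjk hlt
  exact ⟨h.1, h.2.1⟩

/-- ★★★ **`X5.O1.TowerGapAtTwo W` ⟺ the Selmer rank-jump Σ₁ statement** (`W/ℚ` globally minimal, good ordinary at `2`, no rational
`2`-torsion): for every cyclotomic `κ` with a topological generator `γ` that is a cyclotomic variable (the binders of K10), the X-level
gap of cell `bsd-2adic` holds for every dual datum iff `∃ j < k, #Sel_k[2]·#ker g_k·2^{2^j} < #Sel_j[2]·2^{2^k}`. (⇒): K10 ⟹ `X` torsion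
`∧ μ₂ = 0` for the datum `W.selmerDualData κ hγ` (`towerGapAtTwo_iff_isTorsion_and_mu_eq_zero`) ⟹ the Selmer inequality at some pair
(`seedMuZero_iff_exists_selmer_rankJump_two`, Greenberg's Lemma 3.5 over `ℚ`); (⇐): the door. [cite: GreenbergLNM1716, §1 Conj. 1.11; §3 Lemmas 3.1–3.5]
[cite: Washington1997, §13.3 Prop. 13.23] -/
theorem towerGapAtTwo_iff_forall_exists_selmer_rankJump (hord : IsOrdinaryAt W 2)
    (ht : ∀ x : ℚ, ¬ HasRationalTwoTorsionX W x) :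
    TowerGapAtTwo W ↔
      ∀ (κ : ZpExtension ℚ 2) (γ : Field.absoluteGaloisGroup ℚ), κ.IsCyclotomic → κ.IsTopGenerator γ →
        IsCyclotomicVariable 2 γ →
        ∃ j k : ℕ, j < k ∧
          Nat.card ((↥(W.selmerLayer κ k))[(2 : ℤ)]) * Nat.card (W.KerG κ k) * 2 ^ (2 ^ j) <
            Nat.card ((↥(W.selmerLayer κ j))[(2 : ℤ)]) * 2 ^ (2 ^ k) := by
  constructor
  · intro h κ γ hκ hγ hγ'
    obtain ⟨D⟩ := W.nonempty_selmerDualData_holds κ γ hγ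
    exact (seedMuZero_iff_exists_selmer_rankJump_two W hord ht κ hκ hγ D).mp
      ((towerGapAtTwo_iff_isTorsion_and_mu_eq_zero W).mp h κ γ hκ hγ hγ' D)
  · intro h
    refine (towerGapAtTwo_iff_isTorsion_and_mu_eq_zero W).mpr fun κ γ hκ hγ hγ' D ↦ ?_
    obtain ⟨j, k, hjk, hlt⟩ := h κ γ hκ hγ hγ'
    have h' := seedMuZero_of_selmer_rankJump_two W hord ht κ hκ hγ D hjk hlt
    exact ⟨h'.1, h'.2.1⟩

end Summit.BirchSwinnertonDyer.BirchSwinnertonDyer.Theorems.AlignedTransportAtTwoSelmerLayerMuDoorTowerGap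

end
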